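import Mathlib.Topology.ContinuousMap.Bounded.ArzelaAscoli
import Mathlib.MeasureTheory.Function.LpSpace.ContinuousFunctions
import Mathlib.Analysis.Normed.Operator.Compact.Basic
import Literature.NumberTheory.Automorphic.InvariantMeasureDomination
import HarnessLib

/-!
# Orbital smoothing operators on `L²` of a compact homogeneous space are compact
(Gelfand–Graev–Piatetski-Shapiro (1969), Ch. 1 §2; Deitmar–Echterhoff, *Principles of Harmonic
Analysis* (2014), Thm. 9.2.2 with Lemma 9.2.6; Borel (1997), §9)

Topic `NumberTheory/Automorphic`; namespace `Literature.NumberTheory.Automorphic`. Abstract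
measure theory / functional analysis (Mathlib only), continuing `InvariantMeasureDomination`:
a locally compact group `G` acts on a space `X`, `μ` is a finite invariant measure on `X` positive
on non-empty open sets, `ν` is a left invariant measure on `G` finite on compact sets (a left Haar
measure), and `x₀ ∈ X` has an open, continuous, surjective orbit map `g ↦ g • x₀` (every point of
a coset space `G ⧸ H`, any subgroup `H`). The *orbital smoothing* by a weight `η ∈ C_c(G)` is
`S_η f (x) = ∫_G η(g) f(g⁻¹ • x) dν(g)`; it represents the integrated regular representation
`R(η) f = ∫ η(g) R(g) f dν(g)` on `L²(X, μ)` (`coeFn_integral_smul_domSMul_ae_eq`).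

**Main result** (`isCompactOperator_of_coeFn_ae_eq_orbitalSmoothing`): *if `X` is compact, every
bounded operator `T` on `L²(X, μ)` represented by `S_η` (`T f = S_η f` a.e. for all `f`) is a
compact operator.* This is the analytic input of the theorem of Gelfand–Graev–Piatetski-Shapiro
(`L²` of a compact quotient decomposes discretely; Deitmar–Echterhoff Thm. 9.2.2), whose printed
proofs show that `R(f)` is an integral operator with continuous kernel on the compact space, hence
Hilbert–Schmidt (Deitmar–Echterhoff Lemma 9.2.6; GGPS Ch. 1 §2). Mathlib has no Hilbert–Schmidt
operators, so we prove compactness through **Arzelà–Ascoli** instead (the route of Borel (1997),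
§9.4–9.5 / Garrett (2018), §7.2, "`R(η)` maps bounded sets of `L²` to bounded equicontinuous
families"), using only the four axioms on `μ` and the domination lemma of
`InvariantMeasureDomination` (no unfolding, no uniqueness of invariant measures, no unimodularity):

1. `exists_isCompact_transversal` — `X` compact ⇒ a compact `Θ ⊆ G` with `Θ • x₀ = X`.
2. `exists_nhds_one_forall_norm_sub_le_left` — a continuous compactly supported `η` is *left*
   uniformly continuous: `‖η(v k) - η(k)‖ ≤ δ` for `v` near `1`, all `k` (right uniformity).
3. `norm_integral_smul_comp_inv_smul_le` — `‖∫ ζ(h) f(h⁻¹ • x₀) dν(h)‖ ≤ M · C · ‖f‖₁` for `ζ`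
   bounded by `M` and supported in a compact `D` with domination constant `C`
   (`exists_measure_inter_invOrbitPreimage_le`).
4. `exists_orbitalSmoothing_bounds` — hence, with `D = closure (Θ⁻¹ V₀⁻¹ supp η)`: the uniform
   bound `‖S_η f (x)‖ ≤ M C ‖f‖₁` and the equicontinuity estimate
   `‖S_η f (v • x) - S_η f (x)‖ ≤ δ C ‖f‖₁` for `v` in a neighbourhood of `1` depending only on
   `δ` (`S_η f (v θ • x₀) - S_η f (θ • x₀) = ∫ (η(v θ h) - η(θ h)) f(h⁻¹ • x₀) dν(h)` by left
   invariance, `orbitalSmoothing_smul`).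
5. `isCompactOperator_of_coeFn_ae_eq_orbitalSmoothing` — the `S_η f`, `‖f‖_{L²} ≤ 1`, form a
   bounded equicontinuous family of continuous functions on the compact `X`
   (`continuous_orbitalSmoothing`, `‖f‖₁ ≤ μ(X)^{1/2} ‖f‖₂`), so by
   `BoundedContinuousFunction.arzela_ascoli` they are totally bounded in sup norm, hence their
   classes are totally bounded in `L²(μ)` (`BoundedContinuousFunction.toLp` is Lipschitz), i.e.
   `T` maps the unit ball to a relatively compact set.

## References

* I. M. Gelfand, M. I. Graev, I. I. Piatetski-Shapiro, *Representation theory and automorphic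
  functions* (1969), Ch. 1 §2 [GelfandGraevPiatetskiShapiro1969].
* A. Deitmar, S. Echterhoff, *Principles of harmonic analysis*, 2nd ed. (2014), §9.2, Lemma 9.2.6,
  Thm. 9.2.2 [DeitmarEchterhoff2014].
* A. Borel, *Automorphic forms on `SL₂(ℝ)`* (1997), §9 (compact operators from equicontinuity).
-/

noncomputable section

open MeasureTheory Measure Set Filter Topology BoundedContinuousFunction
open scoped ENNReal NNReal Pointwise Uniformity

namespace Literature.NumberTheory.Automorphic

/-! ### Left uniform continuity of compactly supported functions -/

section UniformContinuity

variable {G : Type*} [Group G] [TopologicalSpace G] [IsTopologicalGroup G]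

/-- **A continuous compactly supported function on a topological group is left uniformly
continuous**: for every `δ > 0` there is a neighbourhood `V` of `1` with `‖η(v k) - η(k)‖ ≤ δ` for
all `k` and all `v ∈ V` (Heine–Cantor for the *right* uniformity `(x, y) ↦ y x⁻¹`, Mathlib
`IsTopologicalGroup.rightUniformSpace`; Deitmar–Echterhoff (2014), Lemma 1.3.8). Companion of the
right-handed `exists_nhds_one_forall_abs_sub_le` of `TestFunctionGLDense`. [folklore] -/
theorem exists_nhds_one_forall_norm_sub_le_left {E : Type*} [SeminormedAddCommGroup E]
    {η : G → E} (hη : Continuous η) (hηs : HasCompactSupport η) {δ : ℝ} (hδ : 0 < δ) :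
    ∃ V ∈ 𝓝 (1 : G), ∀ v ∈ V, ∀ k : G, ‖η (v * k) - η k‖ ≤ δ := by
  letI : UniformSpace G := IsTopologicalGroup.rightUniformSpace G
  have hu : UniformContinuous η := hηs.uniformContinuous_of_continuous hη
  have hmem : (fun p : G × G => (η p.1, η p.2)) ⁻¹' {q : E × E | dist q.1 q.2 < δ} ∈ 𝓤 G :=
    hu (Metric.dist_mem_uniformity hδ)
  have hU : 𝓤 G = comap (fun p : G × G => p.2 * p.1⁻¹) (𝓝 1) := rfl
  rw [hU, mem_comap] at hmem
  obtain ⟨U, hU1, hUsub⟩ := hmem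
  refine ⟨U, hU1, fun v hv k => ?_⟩
  have h : (k, v * k) ∈ (fun p : G × G => p.2 * p.1⁻¹) ⁻¹' U := by
    show v * k * k⁻¹ ∈ U
    rwa [mul_inv_cancel_right]
  have h' := hUsub h
  simp only [mem_preimage, mem_setOf_eq] at h'
  rw [dist_eq_norm] at h'
  rw [← norm_neg, neg_sub]
  exact h'.le

end UniformContinuity

/-! ### A compact transversal of a compact orbit -/

section Transversal

variable {G X : Type*} [Group G] [TopologicalSpace G] [IsTopologicalGroup G] [MulAction G X]
  [TopologicalSpace X]

/-- **Compact transversal.** If `X` is compact and the orbit map of `x₀` is open and surjective,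
there is a compact `Θ ⊆ G` with `Θ • x₀ = X`: finitely many translates `(B° θᵢ) • x₀` of the image
of the interior of a compact neighbourhood `B` of `1` cover `X`, and `Θ = B {θ₁, …, θₘ}`
(Deitmar–Echterhoff (2014), §9.2, the compactness of `Γ \ G` used through a compact set of
representatives). [folklore] -/
theorem exists_isCompact_transversal [CompactSpace X] [WeaklyLocallyCompactSpace G] {x₀ : X}
    (hx₀ : IsOpenMap fun g : G => g • x₀) (hsurj : Function.Surjective fun g : G => g • x₀) :
    ∃ Θ : Set G, IsCompact Θ ∧ ∀ x : X, ∃ θ ∈ Θ, θ • x₀ = x := by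
  obtain ⟨B, hBc, hB1⟩ := exists_compact_mem_nhds (1 : G)
  set U : G → Set X := fun θ =>
    (fun g : G => g • x₀) '' ((fun b : G => b * θ) '' interior B) with hU
  have hUo : ∀ θ, IsOpen (U θ) := fun θ =>
    hx₀ _ ((isOpenMap_mul_right θ) _ isOpen_interior)
  have hcov : (univ : Set X) ⊆ ⋃ θ, U θ := by
    intro x _
    obtain ⟨θ, rfl⟩ := hsurj x
    exact mem_iUnion.2 ⟨θ, 1 * θ, ⟨1, mem_interior_iff_mem_nhds.2 hB1, rfl⟩, by simp⟩
  obtain ⟨t, ht⟩ := isCompact_univ.elim_finite_subcover U hUo hcov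
  refine ⟨B * (t : Set G), hBc.mul t.finite_toSet.isCompact, fun x => ?_⟩
  obtain ⟨θ, hθ, hx⟩ := mem_iUnion₂.1 (ht (mem_univ x))
  obtain ⟨_, ⟨b, hb, rfl⟩, rfl⟩ := hx
  exact ⟨b * θ, mul_mem_mul (interior_subset hb) (Finset.mem_coe.2 hθ), rfl⟩

/-- The orbit map of every point of the orbit of `x₀` is open when that of `x₀` is
(`g • (θ • x₀) = (g θ) • x₀` and right translations are homeomorphisms). [folklore] -/
theorem isOpenMap_smul_of_smul_eq {x₀ x : X}
    (hx₀ : IsOpenMap fun g : G => g • x₀) {θ : G} (hθ : θ • x₀ = x) :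
    IsOpenMap fun g : G => g • x := by
  have h : (fun g : G => g • x) = (fun g : G => g • x₀) ∘ fun g => g * θ := by
    funext g
    simp only [Function.comp_apply, ← hθ, mul_smul]
  rw [h]
  exact hx₀.comp (isOpenMap_mul_right θ)

end Transversal

/-! ### The uniform bound and the equicontinuity estimate -/

section Estimates

variable {G X : Type*} [Group G] [TopologicalSpace G] [IsTopologicalGroup G]
  [MeasurableSpace G] [BorelSpace G]
  [MulAction G X] [TopologicalSpace X] [MeasurableSpace X] [OpensMeasurableSpace X]
  [MeasurableSMul₂ G X]
  (μ : Measure X) (ν : Measure G) [IsFiniteMeasure μ] [SFinite ν] [SMulInvariantMeasure G X μ]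
  [μ.IsOpenPosMeasure] [ν.IsMulLeftInvariant] [IsFiniteMeasureOnCompacts ν]

omit [TopologicalSpace X] [OpensMeasurableSpace X] [IsFiniteMeasure μ] [SFinite ν] [μ.IsOpenPosMeasure]
  [ν.IsMulLeftInvariant] [IsFiniteMeasureOnCompacts ν] in
/-- **Pointwise bound for weighted orbit integrals.** If `ζ` is bounded by `M` and vanishes off a
measurable set `D ⊆ G` whose orbital pushforward at `x₀` is dominated by `C μ`
(`exists_measure_inter_invOrbitPreimage_le`), then for `f ∈ L¹(μ)`:
`‖∫ ζ(h) f(h⁻¹ • x₀) dν(h)‖ ≤ M · C · ∫ ‖f‖ dμ` (Deitmar–Echterhoff (2014), proof of Lemma 9.2.6: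
the kernel estimate behind `‖R(f) φ‖_∞ ≪ ‖φ‖`). [folklore] -/
theorem norm_integral_smul_comp_inv_smul_le {x₀ : X} {D : Set G} (hDm : MeasurableSet D)
    {C : ℝ≥0∞} (hC : C ≠ ∞)
    (hdom : ∀ E : Set X, MeasurableSet E → ν (D ∩ invOrbitPreimage x₀ E) ≤ C * μ E)
    {ζ : G → ℂ} {M : ℝ} (hM : ∀ h, ‖ζ h‖ ≤ M) (hζD : ∀ h, ζ h ≠ 0 → h ∈ D)
    {f : X → ℂ} (hf : Integrable f μ) (hfm : Measurable fun x => ‖f x‖) :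
    ‖∫ h, ζ h • f (h⁻¹ • x₀) ∂ν‖ ≤ M * (C.toReal * ∫ x, ‖f x‖ ∂μ) := by
  have hM0 : 0 ≤ M := (norm_nonneg _).trans (hM 1)
  have hfD : IntegrableOn (fun g : G => f (g⁻¹ • x₀)) D ν :=
    Integrable.comp_inv_smul μ ν hC hdom hf
  have hb : Integrable (fun h => M * D.indicator (fun h => ‖f (h⁻¹ • x₀)‖) h) ν :=
    (IntegrableOn.integrable_indicator (Integrable.norm hfD) hDm).const_mul M
  calc ‖∫ h, ζ h • f (h⁻¹ • x₀) ∂ν‖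
      ≤ ∫ h, M * D.indicator (fun h => ‖f (h⁻¹ • x₀)‖) h ∂ν := by
        refine norm_integral_le_of_norm_le hb (Eventually.of_forall fun h => ?_)
        by_cases hh : h ∈ D
        · rw [indicator_of_mem hh, norm_smul]
          exact mul_le_mul_of_nonneg_right (hM h) (norm_nonneg _)
        · have h0 : ζ h = 0 := by
            by_contra hne
            exact hh (hζD h hne)
          rw [h0, zero_smul, norm_zero, indicator_of_notMem hh, mul_zero]
    _ = M * ∫ h in D, ‖f (h⁻¹ • x₀)‖ ∂ν := by
        rw [integral_const_mul, integral_indicator hDm]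
    _ ≤ M * (C.toReal * ∫ x, ‖f x‖ ∂μ) := by
        refine mul_le_mul_of_nonneg_left ?_ hM0
        have h1 := integral_smul_inv_smul_le μ ν hC hdom hfm (fun x => norm_nonneg (f x))
          hf.norm (1 : G)
        simpa only [one_smul] using h1

/-- Weighted orbit functions `h ↦ ζ(h) f(h⁻¹ • x₀)` are integrable for `ζ ∈ C_c(G)` and
`f ∈ L¹(μ)`, when the orbit map of `x₀` is open (domination on the support of `ζ`). A private
special case of `integrable_smul_comp_inv_smul` of `SmoothedCuspForms` (not imported, to keep this
file on Mathlib and `InvariantMeasureDomination` only). [folklore] -/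
private theorem integrable_smul_comp_inv_smul_aux [LocallyCompactSpace G] {x₀ : X}
    (hx₀ : IsOpenMap fun g : G => g • x₀) {ζ : G → ℂ} (hζ : Continuous ζ)
    (hζs : HasCompactSupport ζ) {f : X → ℂ} (hf : Integrable f μ) :
    Integrable (fun h => ζ h • f (h⁻¹ • x₀)) ν := by
  set D : Set G := tsupport ζ with hD
  have hDc : IsCompact D := hζs
  obtain ⟨C, hC, hdom⟩ := exists_measure_inter_invOrbitPreimage_le μ ν hx₀ hDc
  have hfD : IntegrableOn (fun g : G => f (g⁻¹ • x₀)) D ν :=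
    Integrable.comp_inv_smul μ ν hC hdom hf
  obtain ⟨M, hM⟩ := hζ.bounded_above_of_compact_support hζs
  have hg : Integrable (D.indicator fun g : G => f (g⁻¹ • x₀)) ν :=
    hfD.integrable_indicator (isClosed_tsupport ζ).measurableSet
  have h := hg.bdd_smul M hζ.aestronglyMeasurable (Eventually.of_forall hM)
  refine h.congr (Eventually.of_forall fun g => ?_)
  simp only [Pi.smul_apply']
  by_cases hg' : g ∈ D
  · rw [indicator_of_mem hg']
  · rw [indicator_of_notMem hg', smul_zero, image_eq_zero_of_notMem_tsupport hg', zero_smul]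

/-- **Uniform bound and equicontinuity of orbital smoothings on a compact orbit**
(Borel (1997), §9.5; Deitmar–Echterhoff (2014), Lemma 9.2.6). Let `X` be compact with open
surjective orbit map at `x₀` and `η ∈ C_c(G)`. There are constants `M ≥ 0`, `C ≥ 0` such that for
every `f ∈ L¹(μ)` (with `‖f‖` measurable):
* `‖S_η f (x)‖ ≤ M C ∫ ‖f‖ dμ` for all `x`, and
* for every `δ > 0` there is a neighbourhood `V` of `1`, independent of `f`, with
  `‖S_η f (v • x) - S_η f (x)‖ ≤ δ C ∫ ‖f‖ dμ` for all `x` and all `v ∈ V`.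
Here `C` is the domination constant of the compact set `closure (Θ⁻¹ V₀⁻¹ supp η)` for a compact
transversal `Θ` and a compact neighbourhood `V₀` of `1`, and `M = sup ‖η‖`. [folklore] -/
theorem exists_orbitalSmoothing_bounds [CompactSpace X] [LocallyCompactSpace G] {η : G → ℂ}
    (hη : Continuous η) (hηs : HasCompactSupport η) {x₀ : X}
    (hx₀ : IsOpenMap fun g : G => g • x₀) (hsurj : Function.Surjective fun g : G => g • x₀) :
    ∃ M C : ℝ, 0 ≤ M ∧ 0 ≤ C ∧
      (∀ f : X → ℂ, Integrable f μ → Measurable (fun x => ‖f x‖) →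
        ∀ x, ‖orbitalSmoothing ν η f x‖ ≤ M * (C * ∫ x, ‖f x‖ ∂μ)) ∧
      ∀ δ : ℝ, 0 < δ → ∃ V ∈ 𝓝 (1 : G), ∀ f : X → ℂ, Integrable f μ →
        Measurable (fun x => ‖f x‖) → ∀ x, ∀ v ∈ V,
          ‖orbitalSmoothing ν η f (v • x) - orbitalSmoothing ν η f x‖ ≤ δ * (C * ∫ x, ‖f x‖ ∂μ) := by
  obtain ⟨Θ, hΘc, hΘ⟩ := exists_isCompact_transversal hx₀ hsurj
  obtain ⟨V₀, hV₀c, hV₀1⟩ := exists_compact_mem_nhds (1 : G)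
  have h1V₀ : (1 : G) ∈ V₀ := mem_of_mem_nhds hV₀1
  have h1V₀' : (1 : G) ∈ V₀⁻¹ := by rw [Set.mem_inv, inv_one]; exact h1V₀
  set K : Set G := tsupport η with hK
  have hKc : IsCompact K := hηs
  set D : Set G := closure (Θ⁻¹ * (V₀⁻¹ * K)) with hD
  have hDc : IsCompact D := (hΘc.inv.mul (hV₀c.inv.mul hKc)).closure
  have hDm : MeasurableSet D := isClosed_closure.measurableSet
  obtain ⟨C, hC, hdom⟩ := exists_measure_inter_invOrbitPreimage_le μ ν hx₀ hDc
  obtain ⟨M, hM⟩ := hη.bounded_above_of_compact_support hηs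
  have hM0 : 0 ≤ M := (norm_nonneg _).trans (hM 1)
  -- the common estimate: `ζ` bounded by `M'`, supported in `V₀⁻¹ K`, translated by `θ ∈ Θ`
  have key : ∀ θ ∈ Θ, ∀ (ζ : G → ℂ) (M' : ℝ), (∀ k, ‖ζ k‖ ≤ M') →
      (∀ k, ζ k ≠ 0 → k ∈ V₀⁻¹ * K) →
      ∀ f : X → ℂ, Integrable f μ → Measurable (fun x => ‖f x‖) →
        ‖∫ h, ζ (θ * h) • f (h⁻¹ • x₀) ∂ν‖ ≤ M' * (C.toReal * ∫ x, ‖f x‖ ∂μ) := by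
    intro θ hθ ζ M' hM' hζ f hf hfm
    refine norm_integral_smul_comp_inv_smul_le μ ν hDm hC hdom (fun h => hM' (θ * h))
      (fun h hh => ?_) hf hfm
    exact subset_closure ⟨θ⁻¹, Set.inv_mem_inv.2 hθ, θ * h, hζ _ hh, inv_mul_cancel_left θ h⟩
  -- integrability of the translated weighted orbit functions
  have hint : ∀ (c : G) (f : X → ℂ), Integrable f μ →
      Integrable (fun h => η (c * h) • f (h⁻¹ • x₀)) ν := fun c f hf =>
    integrable_smul_comp_inv_smul_aux μ ν hx₀ (hη.comp (continuous_const.mul continuous_id))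
      (hηs.comp_homeomorph (Homeomorph.mulLeft c)) hf
  refine ⟨M, C.toReal, hM0, ENNReal.toReal_nonneg, ?_, ?_⟩
  · intro f hf hfm x
    obtain ⟨θ, hθ, rfl⟩ := hΘ x
    rw [orbitalSmoothing_smul ν η f x₀ θ]
    refine key θ hθ η M hM (fun k hk => ?_) f hf hfm
    exact ⟨1, h1V₀', k, subset_tsupport _ hk, one_mul k⟩
  · intro δ hδ
    obtain ⟨V, hV1, hV⟩ := exists_nhds_one_forall_norm_sub_le_left hη hηs hδ
    refine ⟨V ∩ V₀, inter_mem hV1 hV₀1, fun f hf hfm x v hv => ?_⟩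
    obtain ⟨θ, hθ, rfl⟩ := hΘ x
    rw [← mul_smul, orbitalSmoothing_smul ν η f x₀ (v * θ), orbitalSmoothing_smul ν η f x₀ θ,
      ← integral_sub ((hint (v * θ) f hf)) (hint θ f hf)]
    simp_rw [← sub_smul, mul_assoc]
    refine key θ hθ (fun k => η (v * k) - η k) δ (fun k => hV v hv.1 k) (fun k hk => ?_) f hf hfm
    by_cases hk0 : η k = 0
    · have hvk : η (v * k) ≠ 0 := by rwa [hk0, sub_zero] at hk
      exact ⟨v⁻¹, Set.inv_mem_inv.2 hv.2, v * k, subset_tsupport _ hvk, inv_mul_cancel_left v k⟩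
    · exact ⟨1, h1V₀', k, subset_tsupport _ hk0, one_mul k⟩

end Estimates

/-! ### Compactness via Arzelà–Ascoli -/

section Compact

variable {G X : Type*} [Group G] [TopologicalSpace G] [IsTopologicalGroup G]
  [MeasurableSpace G] [BorelSpace G] [LocallyCompactSpace G] [FirstCountableTopology G]
  [MulAction G X] [TopologicalSpace X] [MeasurableSpace X] [BorelSpace X]
  [MeasurableSMul₂ G X] [CompactSpace X]
  (μ : Measure X) (ν : Measure G) [IsFiniteMeasure μ] [SFinite ν] [SMulInvariantMeasure G X μ]
  [μ.IsOpenPosMeasure] [ν.IsMulLeftInvariant] [IsFiniteMeasureOnCompacts ν]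

omit [TopologicalSpace G] [IsTopologicalGroup G] [BorelSpace G] [LocallyCompactSpace G]
  [FirstCountableTopology G] [MulAction G X] [TopologicalSpace X] [BorelSpace X]
  [MeasurableSMul₂ G X] [CompactSpace X] [SFinite ν] [SMulInvariantMeasure G X μ]
  [μ.IsOpenPosMeasure] [ν.IsMulLeftInvariant] [IsFiniteMeasureOnCompacts ν] in
/-- `‖f‖_{L¹(μ)} ≤ μ(X)^{1/2} ‖f‖_{L²(μ)}` for a finite measure (Cauchy–Schwarz; Mathlib
`eLpNorm_le_eLpNorm_mul_rpow_measure_univ`). [folklore] -/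
theorem integral_norm_le_mul_norm_L2 (f : Lp ℂ 2 μ) :
    ∫ x, ‖(f : X → ℂ) x‖ ∂μ ≤ (μ univ ^ (1 / 2 : ℝ)).toReal * ‖f‖ := by
  have hfm := Lp.aestronglyMeasurable f
  rw [integral_norm_eq_lintegral_enorm hfm, ← eLpNorm_one_eq_lintegral_enorm, Lp.norm_def,
    mul_comm, ← ENNReal.toReal_mul]
  refine ENNReal.toReal_mono (ENNReal.mul_ne_top (Lp.eLpNorm_ne_top f)
    (ENNReal.rpow_ne_top_of_nonneg (by norm_num) (measure_ne_top μ _))) ?_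
  have h := eLpNorm_le_eLpNorm_mul_rpow_measure_univ (p := 1) (q := 2) (μ := μ) (by norm_num) hfm
  have he : (1 / (1 : ℝ≥0∞).toReal - 1 / (2 : ℝ≥0∞).toReal : ℝ) = 1 / 2 := by norm_num
  rwa [he] at h

/-- **Orbital smoothing operators on `L²` of a compact homogeneous space are compact**
(Gelfand–Graev–Piatetski-Shapiro (1969), Ch. 1 §2; Deitmar–Echterhoff (2014), Thm. 9.2.2 /
Lemma 9.2.6: `R(f)` is Hilbert–Schmidt on `L²(Γ \ G)` for `Γ \ G` compact; here via
Arzelà–Ascoli, Borel (1997), §9.5). Let `G` be locally compact (first countable), `X` compact with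
a finite invariant measure `μ` positive on open sets, `ν` left invariant and finite on compacts,
`x₀` a point with open, continuous, surjective orbit map, and `η ∈ C_c(G)`. If a bounded operator
`T` on `L²(X, μ)` is represented by the orbital smoothing, `T f = S_η f` `μ`-a.e. for every `f`
(the case of the integrated regular representation `R(η)`, `coeFn_integral_smul_domSMul_ae_eq`),
then `T` is a compact operator: the `S_η f`, `‖f‖₂ ≤ 1`, are uniformly bounded and equicontinuous
(`exists_orbitalSmoothing_bounds`), hence totally bounded in `C(X)` by Arzelà–Ascoli, hence in
`L²(μ)`. [cite: DeitmarEchterhoff2014, Thm. 9.2.2] -/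
theorem isCompactOperator_of_coeFn_ae_eq_orbitalSmoothing {η : G → ℂ} (hη : Continuous η)
    (hηs : HasCompactSupport η) {x₀ : X} (hx₀ : IsOpenMap fun g : G => g • x₀)
    (hsurj : Function.Surjective fun g : G => g • x₀) (hcont : Continuous fun g : G => g • x₀)
    (T : Lp ℂ 2 μ →L[ℂ] Lp ℂ 2 μ)
    (hT : ∀ f : Lp ℂ 2 μ, ((T f : Lp ℂ 2 μ) : X → ℂ) =ᵐ[μ] orbitalSmoothing ν η (f : X → ℂ)) :
    IsCompactOperator T := by
  obtain ⟨M, C, hM0, hC0, hbound, hequi⟩ := exists_orbitalSmoothing_bounds μ ν hη hηs hx₀ hsurj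
  -- `L¹ ≤ c L²`
  set c : ℝ := (μ univ ^ (1 / 2 : ℝ)).toReal with hc
  have hc0 : 0 ≤ c := ENNReal.toReal_nonneg
  have hL1 : ∀ f : Lp ℂ 2 μ, ∫ x, ‖(f : X → ℂ) x‖ ∂μ ≤ c * ‖f‖ := integral_norm_le_mul_norm_L2 μ
  have hfi : ∀ f : Lp ℂ 2 μ, Integrable (f : X → ℂ) μ := fun f =>
    (Lp.memLp f).integrable one_le_two
  have hfm : ∀ f : Lp ℂ 2 μ, Measurable fun x => ‖(f : X → ℂ) x‖ := fun f =>
    (Lp.stronglyMeasurable f).measurable.norm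
  -- the bounded continuous function `S_η f`
  have hSc : ∀ f : Lp ℂ 2 μ, Continuous (orbitalSmoothing ν η (f : X → ℂ)) := fun f =>
    continuous_orbitalSmoothing μ ν hx₀ hsurj hcont hη hηs (hfi f)
  let Φ : Lp ℂ 2 μ → (X →ᵇ ℂ) := fun f => mkOfCompact ⟨_, hSc f⟩
  have hΦ : ∀ f x, Φ f x = orbitalSmoothing ν η (f : X → ℂ) x := fun f x => rfl
  set A : Set (X →ᵇ ℂ) := Φ '' Metric.closedBall 0 1 with hA
  -- on the unit ball, `∫ ‖f‖ ≤ c`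
  have hball : ∀ f ∈ Metric.closedBall (0 : Lp ℂ 2 μ) 1, ∫ x, ‖(f : X → ℂ) x‖ ∂μ ≤ c := by
    intro f hf
    rw [Metric.mem_closedBall, dist_zero_right] at hf
    calc ∫ x, ‖(f : X → ℂ) x‖ ∂μ ≤ c * ‖f‖ := hL1 f
      _ ≤ c * 1 := mul_le_mul_of_nonneg_left hf hc0
      _ = c := mul_one c
  -- Arzelà–Ascoli: the closure of `A` is compact in `C(X)`
  have hAc : IsCompact (closure A) := by
    refine arzela_ascoli (Metric.closedBall (0 : ℂ) (M * (C * c))) (isCompact_closedBall _ _) A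
      ?_ ?_
    · rintro φ x ⟨f, hf, rfl⟩
      rw [Metric.mem_closedBall, dist_zero_right, hΦ]
      calc ‖orbitalSmoothing ν η (f : X → ℂ) x‖ ≤ M * (C * ∫ x, ‖(f : X → ℂ) x‖ ∂μ) :=
            hbound _ (hfi f) (hfm f) x
        _ ≤ M * (C * c) :=
            mul_le_mul_of_nonneg_left (mul_le_mul_of_nonneg_left (hball f hf) hC0) hM0
    · intro x
      rw [Metric.equicontinuousAt_iff_right]
      intro ε hε
      obtain ⟨δ, hδ, hδε⟩ : ∃ δ : ℝ, 0 < δ ∧ δ * (C * c) < ε :=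
        ⟨ε / (C * c + 1), by positivity, by
          rw [div_mul_eq_mul_div, div_lt_iff₀ (by positivity)]; nlinarith⟩
      obtain ⟨V, hV1, hV⟩ := hequi δ hδ
      obtain ⟨θ, -, hθ⟩ : ∃ θ : G, True ∧ θ • x₀ = x := let ⟨θ, h⟩ := hsurj x; ⟨θ, trivial, h⟩
      have hN : (fun g : G => g • x) '' V ∈ 𝓝 x := by
        have h := (isOpenMap_smul_of_smul_eq hx₀ hθ).image_mem_nhds hV1
        rwa [one_smul] at h
      filter_upwards [hN] with y hy
      obtain ⟨v, hvV, rfl⟩ := hy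
      rintro ⟨φ, f, hf, rfl⟩
      change dist (Φ f x) (Φ f (v • x)) < ε
      rw [dist_eq_norm, hΦ, hΦ, ← norm_neg, neg_sub]
      calc ‖orbitalSmoothing ν η (f : X → ℂ) (v • x) - orbitalSmoothing ν η (f : X → ℂ) x‖
          ≤ δ * (C * ∫ x, ‖(f : X → ℂ) x‖ ∂μ) := hV _ (hfi f) (hfm f) x v hvV
        _ ≤ δ * (C * c) :=
            mul_le_mul_of_nonneg_left (mul_le_mul_of_nonneg_left (hball f hf) hC0) hδ.le
        _ < ε := hδε
  -- transport total boundedness to `L²(μ)`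
  have hAtb : TotallyBounded A := hAc.totallyBounded.subset subset_closure
  have himage : TotallyBounded (BoundedContinuousFunction.toLp (E := ℂ) 2 μ ℂ '' A) :=
    hAtb.image (BoundedContinuousFunction.toLp (E := ℂ) 2 μ ℂ).uniformContinuous
  have hsub : (T : Lp ℂ 2 μ → Lp ℂ 2 μ) '' Metric.closedBall 0 1 ⊆
      BoundedContinuousFunction.toLp (E := ℂ) 2 μ ℂ '' A := by
    rintro _ ⟨f, hf, rfl⟩
    refine ⟨Φ f, ⟨f, hf, rfl⟩, Lp.ext ?_⟩
    filter_upwards [BoundedContinuousFunction.coeFn_toLp (E := ℂ) 2 μ ℂ (Φ f), hT f] with x h1 h2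
    rw [h1, h2, hΦ]
  refine ⟨closure (BoundedContinuousFunction.toLp (E := ℂ) 2 μ ℂ '' A),
    isCompact_iff_totallyBounded_isComplete.2 ⟨himage.closure, isClosed_closure.isComplete⟩, ?_⟩
  exact mem_of_superset (Metric.closedBall_mem_nhds (0 : Lp ℂ 2 μ) one_pos)
    fun f hf => subset_closure (hsub ⟨f, hf, rfl⟩)

end Compact

end Literature.NumberTheory.Automorphic
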